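/-
Origin: expansion seat `prover-pub-hodgecm-mc-sinst-1-g5-0`, handover #1224 2026-08-20T11:03Z md5 c41a253164a0 (296 l., 12 decls) NEW additive leaf; imports #1223 (this kit) + RUN-48 (K11) ArchConjFrameTransportMatrix + RUN-48 #1222 ArchLeviFactorizationCM + RUN-46 #1217 ArchLineSlotTypeConjArch; ROWDEP #1223; the LEVI SHAPE hP/hQ of m = (toSp(1,k))⁻¹·h₀ at the CM see-saw data + (VT) modulo (STRIP) (`exists_archFactor_eq_smul_cmArchWeilRep_conj`); one `set_option maxHeartbeats 4000000 in`; NAME LIST: HodgeCM.Model.ArchLevi.archAct_conjLeviElt_fst · HodgeCM.Model.ArchLevi.archAct_conjLeviElt_snd · HodgeCM.Model.ArchLevi.exists_archFactor_eq_smul_cmArchWeilRep_conj (`HOME/mc/pub-hodgecm-mc-sinst-1-g5/stage/HodgeCM/Model/ArchConjLeviShape.lean`, md5 c41a253164a0, 296 lines);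
landed by the second packager p2 gen 7 (p2-g7) in gate run 50 as `HodgeCM/Model/ArchConjLeviShape.lean` (verbatim).
-/
/-
Origin: speedrun cell pub-hodgecm, MODEL-CONSTRUCTION sub-cell, lineage mc-sinst-1 (S-instance constructor, BINDER-OWNERS row 5 `S` / row 6 `μ`: (J-μ) slots 2/3,
(VT) items W1–W3 = the LEVI SHAPE of the conjugated see-saw element, TAKEN from period-1-g14 2026-08-20T10:10Z), seat prover-pub-hodgecm-mc-sinst-1-g5-0 (gen 5).
Target in PKG: `HodgeCM/Model/ArchConjLeviShape.lean` (NEW additive leaf; imports sinst `Model/ArchActSlices` (same kit), theta-3 RUN-48 (K11)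
`Model/ArchConjFrameTransportMatrix`, sinst RUN-48 #1222 `Model/ArchLeviFactorizationCM`, sinst RUN-46 #1217 `Model/ArchLineSlotTypeConjArch`).
KERNEL only: 0 records / `def … : Prop` / cites-as-hypotheses, 0 proof holes; intended closure {propext, Classical.choice, Quot.sound}.
-/
import Summits.HodgeConjecture.HodgeCM.Model.ArchActSlices
import Summits.HodgeConjecture.HodgeCM.Model.ArchConjFrameTransportMatrix
import Summits.HodgeConjecture.HodgeCM.Model.ArchLeviFactorizationCM
import Summits.HodgeConjecture.HodgeCM.Model.ArchLineSlotTypeConjArch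

/-!
# The LEVI SHAPE of `m = (toSp (1, k))⁻¹ · h₀` for the conjugated see-saw element of the CM data, and (VT) modulo (STRIP)

`h₀ = Res(1 ⊗ g₀) ∘ Λ_C⁻¹ ∈ Sp(𝕎_{T_V ⊗ T_W})(𝔸)` the see-saw element of the rational isometry `g₀ = S.isoGL : diag(a₂,a₃) ⥲ diag(a₀,a₁)`
(`UnitaryDualPairSeesawCMLinesConj`, inside `cmConjLineTensorFin`), `k = g₀,∞ · P_σ Λ = conjTransportK S ∈ U(diag(a₀,a₁))(L⁺ ⊗ ℝ)` theta-3's (K7)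
transport element.  Then `m := toSp(a(1)·b(k_∞))⁻¹ · (e ∘ h₀ ∘ e⁻¹)` acts on archimedean pairs place by place through the REAL matrix
`e (1 ⊗ Λ_{w(v)}⁻¹) e⁻¹` (`k_w⁻¹ g₀(w) = Λ_w⁻¹`, §4), i.e. — by theta-3's (K11) `quadResEnd_oneKronecker_transportInvAt` — as the Levi element
`(J_S⁻¹, J_S⁻¹ ∘ Λ_C⁻¹)`, `J_S = conjFrameTransport V S` ((K9)):

* §4 `conjTransportK_inv_map_evalC_mul_isoGLAt` (`k(w)⁻¹ g₀(w) = Λ_w⁻¹`), `adeleMatAt_inr_inv_mul_oneKronecker_isoGL` (`(b(k⁻¹) (1 ⊗ g₀ ⊗ 1))_w = 1 ⊗ Λ_w⁻¹`);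
* §5 `conjSeesawSp` (= K-1's `seesawElement` at these data, `seesawElement_eq_conjSeesawSp`, `rfl`), `conjLeviElt`, `relabelInvArch`,
  **`placeVec_archAct_conjLeviElt`** (the `v`-slices), **`archAct_conjLeviElt_fst`** (`= J_S⁻¹ a`, #1222's `hP`), **`archAct_conjLeviElt_snd`**
  (`= J_S⁻¹ (Λ_C⁻¹ w)`, `hQ`), and **`exists_archFactor_eq_smul_cmArchWeilRep_conj`** = #1222 with `hP`/`hQ` DISCHARGED:
  (VT) at the CM see-saw data MODULO (STRIP) ONLY — `∃ c, ∀ Φ, A Φ = c • ω_∞(1, k) (Φ ∘ J_S)` for the archimedean factor `A` of any implementer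
  of `e ∘ h₀ ∘ e⁻¹`.

Consumer: `Model/ArchConjLeviVT` (the transport of period-1's product-currency (STRIP) output to this statement).  Nothing here is a claim of PerL/QW8;
nothing is cited as a fact.

References: [Folland1989] G. B. Folland, *Harmonic Analysis in Phase Space*, Princeton UP 1989, Prop. (1.43), Prop. (1.50), Prop. (4.6), (4.24);
[Kudla1984] S. Kudla, *Seesaw dual reductive pairs*, §1; [GelbartRogawski1991] §3.1 p. 454.
-/

set_option autoImplicit false

noncomputable section

open scoped Matrix Classical Kronecker SchwartzMap TensorProduct
open NumberField NumberField.InfinitePlace NumberField.mixedEmbedding IsDedekindDomain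
open Literature.NumberTheory.Automorphic Literature.NumberTheory.Automorphic.UnitaryGroup
open Literature.RepresentationTheory.HeisenbergGroup
open Literature.NumberTheory.Weil1964 Literature.NumberTheory.GelbartRogawski1991 Literature.NumberTheory.GelbartRogawski1991.UnitaryDualPair
open HodgeCM.PerL34 HodgeCM.Model.HypCensus HodgeCM.Model.ArchSideTerm

namespace HodgeCM.Model.ArchLevi

/-! ## §4 the CM data: `k_w⁻¹ · g₀(w) = Λ_w⁻¹` -/

section CM

variable {L : CMField} (S : StubTree.SeesawDatum L)


/-- `(k⁻¹)(w) · g₀(w) = Λ_w⁻¹` for `k = g₀,∞ · P_σ Λ` ((K7) `conjTransportK`). [folklore] -/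
theorem conjTransportK_inv_map_evalC_mul_isoGLAt (w : {w : InfinitePlace (L : Type) // w.IsComplex}) :
    ((((conjTransportK S)⁻¹ : ↥(UnitaryGroup.arch (↥(maximalRealSubfield (L : Type))) (L : Type) (IsCMField.complexConj (L : Type)) 2 (Matrix.diagonal (dW S)))) : GL (Fin 2) (mixedSpace (L : Type))) :
        Matrix (Fin 2) (Fin 2) (mixedSpace (L : Type))).map (evalC (L : Type) w) * isoGLAt S w.1 =
      transportInvAt S w.1 := by
  rw [Subgroup.coe_inv, coe_conjTransportK, mul_inv_rev, Units.val_mul, Matrix.map_mul, ← map_inv (archGL (L : Type)), val_archGL,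
    Matrix.map_map]
  have hinv : (((conjTransportGL S)⁻¹ : GL (Fin 2) (mixedSpace (L : Type))) : Matrix (Fin 2) (Fin 2) (mixedSpace (L : Type))) = transportInv S := rfl
  have hcomp : (⇑(evalC (L : Type) w) ∘ ⇑(mixedEmbedding (L : Type))) = ⇑(w.1.embedding) := rfl
  rw [hinv, transportInv_map_evalC, hcomp, isoGLAt, Matrix.mul_assoc, ← Matrix.map_mul, ← Units.val_mul, inv_mul_cancel, Units.val_one,
    Matrix.map_one _ (map_zero _) (map_one _), Matrix.mul_one]

/-- **the archimedean matrix of `m = (1, k)⁻¹ · (1 ⊗ g₀)` at `w` is `1 ⊗ Λ_w⁻¹`** (REAL: (K7) `transportInvAt`). [folklore] -/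
theorem adeleMatAt_inr_inv_mul_oneKronecker_isoGL {N : ℕ} (JV : Matrix (Fin N) (Fin N) (L : Type))
    (w : {w : InfinitePlace (L : Type) // w.IsComplex}) :
    adeleMatAt (L : Type) (Fin N × Fin 2) w
        ((((UnitaryGroup.adelicInr (↥(maximalRealSubfield (L : Type))) (L : Type) (IsCMField.complexConj (L : Type)) N 2 JV (Matrix.diagonal (dW S))
              (UnitaryGroup.archToAdelic (↥(maximalRealSubfield (L : Type))) (L : Type) (IsCMField.complexConj (L : Type)) 2 (Matrix.diagonal (dW S)) (conjTransportK S)⁻¹) :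
              UnitaryGroup.adelicPair (↥(maximalRealSubfield (L : Type))) (L : Type) (IsCMField.complexConj (L : Type)) N 2 JV (Matrix.diagonal (dW S))) :
            GL (Fin N × Fin 2) (AdeleRing (𝓞 (L : Type)) (L : Type))) : Matrix (Fin N × Fin 2) (Fin N × Fin 2) _) *
          ((1 : Matrix (Fin N) (Fin N) (AdeleRing (𝓞 (L : Type)) (L : Type))) ⊗ₖ
            ((Literature.NumberTheory.Automorphic.toAdeleGL (L : Type) S.isoGL : GL (Fin 2) (AdeleRing (𝓞 (L : Type)) (L : Type))) :
              Matrix (Fin 2) (Fin 2) (AdeleRing (𝓞 (L : Type)) (L : Type))))) =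
      (1 : Matrix (Fin N) (Fin N) ℂ) ⊗ₖ transportInvAt S w.1 := by
  rw [UnitaryGroup.coe_adelicInr, ← Matrix.mul_kronecker_mul, Matrix.one_mul, adeleMatAt, ← kronecker_map_map,
    Matrix.map_one _ (map_zero _) (map_one _)]
  congr 1
  rw [Matrix.map_mul]
  change adeleMatAt (L : Type) (Fin 2) w _ * adeleMatAt (L : Type) (Fin 2) w _ = _
  rw [← adelicVal_apply, adeleMatAt_archToAdelic, adeleMatAt_toAdeleGL]
  exact conjTransportK_inv_map_evalC_mul_isoGLAt S w

end CM

/-! ## §5 the Levi shape of `m = (toSp (1, k))⁻¹ · h₀` at the CM see-saw data -/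

section LeviShape

variable {L : CMField} {ι₁ : L →+* ℂ} (V : HermSpace3 L ι₁) (S : StubTree.SeesawDatum L)

/-- `re σ_{w(v)}(δ_L) = 0` at the chosen complex place over `v`. -/
theorem re_embedding_cmPlaceOver_imagUnit (v : {v : InfinitePlace (↥(maximalRealSubfield (L : Type))) // v.IsReal}) :
    ((cmPlaceOver (L : Type) v).1.embedding (imagUnit (L : Type))).re = 0 :=
  re_embedding_delta (↥(maximalRealSubfield (L : Type))) (L : Type) (IsCMField.complexConj (L : Type)) (cmPlaceOver (L : Type) v)
    (cmPlaceOver_smul (L : Type) v) (IsCMField.complexConj_ne_one (L : Type)) (complexConj_imagUnit (L : Type))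

variable {TW' : Matrix (Fin 2) (Fin 2) (↥(maximalRealSubfield (L : Type)))} (hW' : TW'.IsSymm)
  {JW' : Matrix (Fin 2) (Fin 2) (L : Type)} (hJW' : JW' = TW'.map (algebraMap (↥(maximalRealSubfield (L : Type))) (L : Type)))
  (hg : (((Literature.NumberTheory.Automorphic.toAdeleGL (L : Type) S.isoGL : GL (Fin 2) (AdeleRing (𝓞 (L : Type)) (L : Type))) : Matrix (Fin 2) (Fin 2) (AdeleRing (𝓞 (L : Type)) (L : Type))).map
        (conjAdele (↥(maximalRealSubfield (L : Type))) (L : Type) (IsCMField.complexConj (L : Type))))ᵀ *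
      UnitaryGroup.adelicForm (L : Type) 2 (Matrix.diagonal (dW S)) *
      (Literature.NumberTheory.Automorphic.toAdeleGL (L : Type) S.isoGL : GL (Fin 2) (AdeleRing (𝓞 (L : Type)) (L : Type))) =
    UnitaryGroup.adelicForm (L : Type) 2 JW')
  (C : GL (Fin 3 × Fin 2) (AdeleRing (𝓞 (↥(maximalRealSubfield (L : Type)))) (↥(maximalRealSubfield (L : Type)))))
  (hC : (realDiagonal (L : Type) (frameD V) (frameD_real V)).map (algebraMap (↥(maximalRealSubfield (L : Type))) (AdeleRing (𝓞 (↥(maximalRealSubfield (L : Type)))) (↥(maximalRealSubfield (L : Type))))) ⊗ₖ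
        (realDiagonal (L : Type) (dW S) (dW_real S)).map (algebraMap (↥(maximalRealSubfield (L : Type))) (AdeleRing (𝓞 (↥(maximalRealSubfield (L : Type)))) (↥(maximalRealSubfield (L : Type))))) * (C : Matrix (Fin 3 × Fin 2) (Fin 3 × Fin 2) (AdeleRing (𝓞 (↥(maximalRealSubfield (L : Type)))) (↥(maximalRealSubfield (L : Type))))) =
      (realDiagonal (L : Type) (frameD V) (frameD_real V)).map (algebraMap (↥(maximalRealSubfield (L : Type))) (AdeleRing (𝓞 (↥(maximalRealSubfield (L : Type)))) (↥(maximalRealSubfield (L : Type))))) ⊗ₖ TW'.map (algebraMap (↥(maximalRealSubfield (L : Type))) (AdeleRing (𝓞 (↥(maximalRealSubfield (L : Type)))) (↥(maximalRealSubfield (L : Type))))))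

/-- the product-currency Gram matrix `T_V ⊗ T_W` of the CM pin (`adelicGram finProdFinEquiv … = reindex e e` of it, definitionally). -/
abbrev cmProdGramVS : Matrix (Fin 3 × Fin 2) (Fin 3 × Fin 2) (AdeleRing (𝓞 (↥(maximalRealSubfield (L : Type)))) (↥(maximalRealSubfield (L : Type)))) :=
  (realDiagonal (L : Type) (frameD V) (frameD_real V)).map (algebraMap (↥(maximalRealSubfield (L : Type))) (AdeleRing (𝓞 (↥(maximalRealSubfield (L : Type)))) (↥(maximalRealSubfield (L : Type))))) ⊗ₖ
    (realDiagonal (L : Type) (dW S) (dW_real S)).map (algebraMap (↥(maximalRealSubfield (L : Type))) (AdeleRing (𝓞 (↥(maximalRealSubfield (L : Type)))) (↥(maximalRealSubfield (L : Type)))))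

/-- **the conjugated see-saw element of the CM data**, product currency `Fin 3 × Fin 2`: `h₀ = Res(1 ⊗ g₀) ∘ Λ_C⁻¹` (vendored `adelicSeesawConj`
at `g = g₀ ⊗ 1`, `g₀ = S.isoGL`; the primed Gram `T_W′`, the isometry proof `hg` and the intertwiner `C`, `hC` are PARAMETERS — the consumer
instantiates them with the (34)-currency data of `UnitaryDualPairSeesawCMLinesConj`). -/
abbrev conjSeesawSp :
    symplecticGroup (polar (Matrix.toLinearMap₂' (AdeleRing (𝓞 (↥(maximalRealSubfield (L : Type)))) (↥(maximalRealSubfield (L : Type))))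
      ((realDiagonal (L : Type) (frameD V) (frameD_real V)).map (algebraMap (↥(maximalRealSubfield (L : Type))) (AdeleRing (𝓞 (↥(maximalRealSubfield (L : Type)))) (↥(maximalRealSubfield (L : Type))))) ⊗ₖ
        (realDiagonal (L : Type) (dW S) (dW_real S)).map (algebraMap (↥(maximalRealSubfield (L : Type))) (AdeleRing (𝓞 (↥(maximalRealSubfield (L : Type)))) (↥(maximalRealSubfield (L : Type)))))))) :=
  adelicSeesawConj (↥(maximalRealSubfield (L : Type))) (L : Type) (IsCMField.complexConj (L : Type)) 3 2
    (complexConj_imagUnit (L : Type)) (imagUnit_ne_zero (L : Type)) (imagUnit_mul_self (L : Type))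
    (realDiagonal_isSymm (L : Type) (frameD V) (frameD_real V)) (realDiagonal_isSymm (L : Type) (dW S) (dW_real S)) hW'
    (realDiagonal_map (L : Type) (frameD V) (frameD_real V)).symm (realDiagonal_map (L : Type) (dW S) (dW_real S)).symm hJW'
    (Literature.NumberTheory.Automorphic.toAdeleGL (L : Type) S.isoGL) hg C hC

/-- **the Levi element `m = (toSp (a(1)·b(k_∞)))⁻¹ · (e ∘ h₀ ∘ e⁻¹)`** in the `Fin (3·2)` currency of `cmArchWeilRep` (#1222's `(archPairSp u)⁻¹ * h₀`
at `u = (1, conjTransportK S)`, `h₀ := spReindex finProdFinEquiv (conjSeesawSp …)`). -/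
abbrev conjLeviElt :
    symplecticGroup (polar (adelicForm (↥(maximalRealSubfield (L : Type))) (Fin (3 * 2))
      (adelicGram (↥(maximalRealSubfield (L : Type))) finProdFinEquiv (realDiagonal (L : Type) (frameD V) (frameD_real V)) (realDiagonal (L : Type) (dW S) (dW_real S))))) :=
  (archPairSp (L : Type) finProdFinEquiv (frameD V) (frameD_real V) (dW S) (dW_real S) (1, conjTransportK S))⁻¹ *
    UnitaryGroup.spReindex finProdFinEquiv (cmProdGramVS V S) (conjSeesawSp V S hW' hJW' hg C hC)

/-- the archimedean action of `Λ_C⁻¹` on the second component, read in the `Fin (3·2)` currency. -/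
def relabelInvArch (w : Fin (3 * 2) → mixedSpace (↥(maximalRealSubfield (L : Type)))) : Fin (3 * 2) → mixedSpace (↥(maximalRealSubfield (L : Type))) :=
  (archMat (↥(maximalRealSubfield (L : Type))) (Fin 3 × Fin 2) ((C⁻¹ : GL (Fin 3 × Fin 2) (AdeleRing (𝓞 (↥(maximalRealSubfield (L : Type)))) (↥(maximalRealSubfield (L : Type))))) : Matrix (Fin 3 × Fin 2) (Fin 3 × Fin 2) (AdeleRing (𝓞 (↥(maximalRealSubfield (L : Type)))) (↥(maximalRealSubfield (L : Type))))) *ᵥ (w ∘ finProdFinEquiv)) ∘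
    finProdFinEquiv.symm

set_option maxHeartbeats 4000000 in
/-- **(★) the `v`-slices of `archAct m`**: `Res_{ℂ/ℝ}(e (1 ⊗ Λ_{w(v)}⁻¹) e⁻¹)` on `(a_v, (Λ_C⁻¹ w)_v)`. [folklore] -/
theorem placeVec_archAct_conjLeviElt (v : {v : InfinitePlace (↥(maximalRealSubfield (L : Type))) // v.IsReal}) (a w : Fin (3 * 2) → mixedSpace (↥(maximalRealSubfield (L : Type)))) :
    (placeVec (↥(maximalRealSubfield (L : Type))) (Fin (3 * 2)) v
        (archAct (adelicGram (↥(maximalRealSubfield (L : Type))) finProdFinEquiv (realDiagonal (L : Type) (frameD V) (frameD_real V)) (realDiagonal (L : Type) (dW S) (dW_real S)))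
          (conjLeviElt V S hW' hJW' hg C hC) (a, w)).1,
      placeVec (↥(maximalRealSubfield (L : Type))) (Fin (3 * 2)) v
        (archAct (adelicGram (↥(maximalRealSubfield (L : Type))) finProdFinEquiv (realDiagonal (L : Type) (frameD V) (frameD_real V)) (realDiagonal (L : Type) (dW S) (dW_real S)))
          (conjLeviElt V S hW' hJW' hg C hC) (a, w)).2) =
      (isQuadraticCoordinates_complex ((cmPlaceOver (L : Type) v).1.embedding (imagUnit (L : Type)))
          (re_embedding_cmPlaceOver_imagUnit v) (im_embedding_cmPlaceOver_imagUnit_ne_zero (L : Type) v)).resEnd (Fin (3 * 2))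
        (Matrix.reindex finProdFinEquiv finProdFinEquiv ((1 : Matrix (Fin 3) (Fin 3) ℂ) ⊗ₖ transportInvAt S (placeUp v)))
        (placeVec (↥(maximalRealSubfield (L : Type))) (Fin (3 * 2)) v a, placeVec (↥(maximalRealSubfield (L : Type))) (Fin (3 * 2)) v (relabelInvArch C w)) := by
  -- step 1: `m = e ∘ (toSp(b(k⁻¹)) · h₀) ∘ e⁻¹`
  have h1 : UnitaryGroup.adelicInl (↥(maximalRealSubfield (L : Type))) (L : Type) (IsCMField.complexConj (L : Type)) 3 2 (Matrix.diagonal (frameD V)) (Matrix.diagonal (dW S))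
        (UnitaryGroup.archToAdelic (↥(maximalRealSubfield (L : Type))) (L : Type) (IsCMField.complexConj (L : Type)) 3 (Matrix.diagonal (frameD V)) 1) = 1 :=
    map_one ((UnitaryGroup.adelicInl (↥(maximalRealSubfield (L : Type))) (L : Type) (IsCMField.complexConj (L : Type)) 3 2 (Matrix.diagonal (frameD V)) (Matrix.diagonal (dW S))).comp
      (UnitaryGroup.archToAdelic (↥(maximalRealSubfield (L : Type))) (L : Type) (IsCMField.complexConj (L : Type)) 3 (Matrix.diagonal (frameD V))))
  have h2 : (UnitaryGroup.adelicInr (↥(maximalRealSubfield (L : Type))) (L : Type) (IsCMField.complexConj (L : Type)) 3 2 (Matrix.diagonal (frameD V)) (Matrix.diagonal (dW S))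
        (UnitaryGroup.archToAdelic (↥(maximalRealSubfield (L : Type))) (L : Type) (IsCMField.complexConj (L : Type)) 2 (Matrix.diagonal (dW S)) (conjTransportK S)))⁻¹ =
      UnitaryGroup.adelicInr (↥(maximalRealSubfield (L : Type))) (L : Type) (IsCMField.complexConj (L : Type)) 3 2 (Matrix.diagonal (frameD V)) (Matrix.diagonal (dW S))
        (UnitaryGroup.archToAdelic (↥(maximalRealSubfield (L : Type))) (L : Type) (IsCMField.complexConj (L : Type)) 2 (Matrix.diagonal (dW S)) (conjTransportK S)⁻¹) :=
    (map_inv ((UnitaryGroup.adelicInr (↥(maximalRealSubfield (L : Type))) (L : Type) (IsCMField.complexConj (L : Type)) 3 2 (Matrix.diagonal (frameD V)) (Matrix.diagonal (dW S))).comp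
      (UnitaryGroup.archToAdelic (↥(maximalRealSubfield (L : Type))) (L : Type) (IsCMField.complexConj (L : Type)) 2 (Matrix.diagonal (dW S)))) (conjTransportK S)).symm
  have hpair : (UnitaryGroup.adelicInl (↥(maximalRealSubfield (L : Type))) (L : Type) (IsCMField.complexConj (L : Type)) 3 2 (Matrix.diagonal (frameD V)) (Matrix.diagonal (dW S))
          (UnitaryGroup.archToAdelic (↥(maximalRealSubfield (L : Type))) (L : Type) (IsCMField.complexConj (L : Type)) 3 (Matrix.diagonal (frameD V))
            ((1, conjTransportK S) : ↥(UnitaryGroup.arch (↥(maximalRealSubfield (L : Type))) (L : Type) (IsCMField.complexConj (L : Type)) 3 (Matrix.diagonal (frameD V))) ×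
              ↥(UnitaryGroup.arch (↥(maximalRealSubfield (L : Type))) (L : Type) (IsCMField.complexConj (L : Type)) 2 (Matrix.diagonal (dW S)))).1) *
        UnitaryGroup.adelicInr (↥(maximalRealSubfield (L : Type))) (L : Type) (IsCMField.complexConj (L : Type)) 3 2 (Matrix.diagonal (frameD V)) (Matrix.diagonal (dW S))
          (UnitaryGroup.archToAdelic (↥(maximalRealSubfield (L : Type))) (L : Type) (IsCMField.complexConj (L : Type)) 2 (Matrix.diagonal (dW S))
            ((1, conjTransportK S) : ↥(UnitaryGroup.arch (↥(maximalRealSubfield (L : Type))) (L : Type) (IsCMField.complexConj (L : Type)) 3 (Matrix.diagonal (frameD V))) ×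
              ↥(UnitaryGroup.arch (↥(maximalRealSubfield (L : Type))) (L : Type) (IsCMField.complexConj (L : Type)) 2 (Matrix.diagonal (dW S)))).2))⁻¹ =
      UnitaryGroup.adelicInr (↥(maximalRealSubfield (L : Type))) (L : Type) (IsCMField.complexConj (L : Type)) 3 2 (Matrix.diagonal (frameD V)) (Matrix.diagonal (dW S))
          (UnitaryGroup.archToAdelic (↥(maximalRealSubfield (L : Type))) (L : Type) (IsCMField.complexConj (L : Type)) 2 (Matrix.diagonal (dW S)) (conjTransportK S)⁻¹) := by
    rw [← h2]
    exact congrArg _ (by rw [show ((1, conjTransportK S) : ↥(UnitaryGroup.arch (↥(maximalRealSubfield (L : Type))) (L : Type) (IsCMField.complexConj (L : Type)) 3 (Matrix.diagonal (frameD V))) ×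
              ↥(UnitaryGroup.arch (↥(maximalRealSubfield (L : Type))) (L : Type) (IsCMField.complexConj (L : Type)) 2 (Matrix.diagonal (dW S)))).1 = 1 from rfl, h1, one_mul])
  have hm : conjLeviElt V S hW' hJW' hg C hC = UnitaryGroup.spReindex finProdFinEquiv (cmProdGramVS V S)
      (adelicPairToSymplectic (↥(maximalRealSubfield (L : Type))) (L : Type) (IsCMField.complexConj (L : Type)) 3 2
          (complexConj_imagUnit (L : Type)) (imagUnit_ne_zero (L : Type)) (imagUnit_mul_self (L : Type))
          (realDiagonal_isSymm (L : Type) (frameD V) (frameD_real V)) (realDiagonal_isSymm (L : Type) (dW S) (dW_real S))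
          (realDiagonal_map (L : Type) (frameD V) (frameD_real V)).symm (realDiagonal_map (L : Type) (dW S) (dW_real S)).symm
          (UnitaryGroup.adelicInr (↥(maximalRealSubfield (L : Type))) (L : Type) (IsCMField.complexConj (L : Type)) 3 2 (Matrix.diagonal (frameD V)) (Matrix.diagonal (dW S))
            (UnitaryGroup.archToAdelic (↥(maximalRealSubfield (L : Type))) (L : Type) (IsCMField.complexConj (L : Type)) 2 (Matrix.diagonal (dW S)) (conjTransportK S)⁻¹)) *
        conjSeesawSp V S hW' hJW' hg C hC) := by
    rw [← hpair, map_inv (adelicPairToSymplectic (↥(maximalRealSubfield (L : Type))) (L : Type) (IsCMField.complexConj (L : Type)) 3 2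
          (complexConj_imagUnit (L : Type)) (imagUnit_ne_zero (L : Type)) (imagUnit_mul_self (L : Type))
          (realDiagonal_isSymm (L : Type) (frameD V) (frameD_real V)) (realDiagonal_isSymm (L : Type) (dW S) (dW_real S))
          (realDiagonal_map (L : Type) (frameD V) (frameD_real V)).symm (realDiagonal_map (L : Type) (dW S) (dW_real S)).symm),
      map_mul (UnitaryGroup.spReindex finProdFinEquiv (cmProdGramVS V S)), map_inv (UnitaryGroup.spReindex finProdFinEquiv (cmProdGramVS V S))]
    rfl
  rw [hm, archAct_spReindex]
  -- step 2: product-currency slices, composition, the matrix at `w(v)`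
  have key := placeVec_archAct_pair_mul_seesawConj (↥(maximalRealSubfield (L : Type))) (L : Type) (IsCMField.complexConj (L : Type)) 3 2
    (complexConj_imagUnit (L : Type)) (imagUnit_ne_zero (L : Type)) (imagUnit_mul_self (L : Type))
    (realDiagonal_isSymm (L : Type) (frameD V) (frameD_real V)) (realDiagonal_isSymm (L : Type) (dW S) (dW_real S)) hW'
    (realDiagonal_map (L : Type) (frameD V) (frameD_real V)).symm (realDiagonal_map (L : Type) (dW S) (dW_real S)).symm hJW'
    v (cmPlaceOver (L : Type) v) (cmPlaceOver_comap (L : Type) v) (re_embedding_cmPlaceOver_imagUnit v)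
    (im_embedding_cmPlaceOver_imagUnit_ne_zero (L : Type) v)
    (UnitaryGroup.adelicInr (↥(maximalRealSubfield (L : Type))) (L : Type) (IsCMField.complexConj (L : Type)) 3 2 (Matrix.diagonal (frameD V)) (Matrix.diagonal (dW S))
      (UnitaryGroup.archToAdelic (↥(maximalRealSubfield (L : Type))) (L : Type) (IsCMField.complexConj (L : Type)) 2 (Matrix.diagonal (dW S)) (conjTransportK S)⁻¹))
    (Literature.NumberTheory.Automorphic.toAdeleGL (L : Type) S.isoGL) hg C hC (a ∘ finProdFinEquiv) (w ∘ finProdFinEquiv)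
  rw [adeleMatAt_inr_inv_mul_oneKronecker_isoGL] at key
  -- step 3: back to the `Fin (3·2)` currency
  rw [IsQuadraticCoordinates.resEnd_reindex_apply]
  have hsymm : (reindexW ℝ (finProdFinEquiv : Fin 3 × Fin 2 ≃ Fin (3 * 2))).symm
      (placeVec (↥(maximalRealSubfield (L : Type))) (Fin (3 * 2)) v a, placeVec (↥(maximalRealSubfield (L : Type))) (Fin (3 * 2)) v (relabelInvArch C w)) =
      (placeVec (↥(maximalRealSubfield (L : Type))) (Fin 3 × Fin 2) v (a ∘ finProdFinEquiv),
        placeVec (↥(maximalRealSubfield (L : Type))) (Fin 3 × Fin 2) v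
          (archMat (↥(maximalRealSubfield (L : Type))) (Fin 3 × Fin 2) ((C⁻¹ : GL (Fin 3 × Fin 2) (AdeleRing (𝓞 (↥(maximalRealSubfield (L : Type)))) (↥(maximalRealSubfield (L : Type))))) : Matrix (Fin 3 × Fin 2) (Fin 3 × Fin 2) (AdeleRing (𝓞 (↥(maximalRealSubfield (L : Type)))) (↥(maximalRealSubfield (L : Type))))) *ᵥ
            (w ∘ finProdFinEquiv))) := by
    refine Prod.ext rfl (funext fun ij => ?_)
    simp [reindexW, relabelInvArch, placeVec]
  rw [hsymm, ← key]
  rfl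

/-- **LEVI SHAPE, first component (`hP` of #1221/#1222)**: `(archAct m (a, w)).1 = J_S⁻¹ a`, `J_S = conjFrameTransport V S` ((K9)/(K11)). [folklore] -/
theorem archAct_conjLeviElt_fst (a w : Fin (3 * 2) → mixedSpace (↥(maximalRealSubfield (L : Type)))) :
    (archAct (adelicGram (↥(maximalRealSubfield (L : Type))) finProdFinEquiv (realDiagonal (L : Type) (frameD V) (frameD_real V)) (realDiagonal (L : Type) (dW S) (dW_real S)))
        (conjLeviElt V S hW' hJW' hg C hC) (a, w)).1 = (conjFrameTransport V S).symm a :=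
  eq_of_placeVec_eq _ _ fun v => congrArg Prod.fst ((placeVec_archAct_conjLeviElt V S hW' hJW' hg C hC v a w).trans
    (quadResEnd_oneKronecker_transportInvAt V S _ (re_embedding_cmPlaceOver_imagUnit v) (im_embedding_cmPlaceOver_imagUnit_ne_zero (L : Type) v)
      v a (relabelInvArch C w)))

/-- **LEVI SHAPE, second component (`hQ`)**: `(archAct m (a, w)).2 = J_S⁻¹ (Λ_C⁻¹ w)`. [folklore] -/
theorem archAct_conjLeviElt_snd (a w : Fin (3 * 2) → mixedSpace (↥(maximalRealSubfield (L : Type)))) :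
    (archAct (adelicGram (↥(maximalRealSubfield (L : Type))) finProdFinEquiv (realDiagonal (L : Type) (frameD V) (frameD_real V)) (realDiagonal (L : Type) (dW S) (dW_real S)))
        (conjLeviElt V S hW' hJW' hg C hC) (a, w)).2 = (conjFrameTransport V S).symm (relabelInvArch C w) :=
  eq_of_placeVec_eq _ _ fun v => congrArg Prod.snd ((placeVec_archAct_conjLeviElt V S hW' hJW' hg C hC v a w).trans
    (quadResEnd_oneKronecker_transportInvAt V S _ (re_embedding_cmPlaceOver_imagUnit v) (im_embedding_cmPlaceOver_imagUnit_ne_zero (L : Type) v)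
      v a (relabelInvArch C w)))

/-- **(VT) AT THE CM SEE-SAW DATA, MODULO (STRIP) ONLY**: for an implementer `Mω` of the transported see-saw element
`e ∘ h₀ ∘ e⁻¹` on `𝒮(𝔸^{3·2})` with tensor decomposition `(A, M_f)` ((STRIP)), the archimedean factor is
`A Φ = c • ω_∞(1, k) (Φ ∘ J_S)` — #1222 with `hP`/`hQ` DISCHARGED by `archAct_conjLeviElt_fst/snd`; at `Φ = Φ_{X'}` this is #1218's `hY`
((K9) `compCLM_conjFrameTransport_slotArchBox_linePhi`: `Φ_{X'} ∘ J_S = Φ_X`). [cite: Folland1989, Prop. (1.43), Prop. (1.50), (4.24)] -/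
theorem exists_archFactor_eq_smul_cmArchWeilRep_conj
    (hGR : (cmSplittingDatum (L : Type) finProdFinEquiv (frameD V) (frameD_real V) (frameD_ne V) (dW S) (dW_real S) (dW_ne S)).CompatibleSplitting)
    (h₀ : symplecticGroup (polar (adelicForm (↥(maximalRealSubfield (L : Type))) (Fin (3 * 2))
      (adelicGram (↥(maximalRealSubfield (L : Type))) finProdFinEquiv (realDiagonal (L : Type) (frameD V) (frameD_real V)) (realDiagonal (L : Type) (dW S) (dW_real S))))))
    (hh₀ : h₀ = UnitaryGroup.spReindex finProdFinEquiv (cmProdGramVS V S) (conjSeesawSp V S hW' hJW' hg C hC))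
    (Mω : piSchwartzBruhat (↥(maximalRealSubfield (L : Type))) (Fin (3 * 2)) ≃ₗ[ℂ] piSchwartzBruhat (↥(maximalRealSubfield (L : Type))) (Fin (3 * 2)))
    (hM : Implements (adelicSchrodinger (↥(maximalRealSubfield (L : Type))) (Fin (3 * 2))
        (adelicGram (↥(maximalRealSubfield (L : Type))) finProdFinEquiv (realDiagonal (L : Type) (frameD V) (frameD_real V)) (realDiagonal (L : Type) (dW S) (dW_real S))))
      (ofSymplectic (polar (adelicForm (↥(maximalRealSubfield (L : Type))) (Fin (3 * 2))
        (adelicGram (↥(maximalRealSubfield (L : Type))) finProdFinEquiv (realDiagonal (L : Type) (frameD V) (frameD_real V)) (realDiagonal (L : Type) (dW S) (dW_real S))))) h₀) Mω)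
    (A : 𝓢((Fin (3 * 2) → mixedSpace (↥(maximalRealSubfield (L : Type)))), ℂ) →L[ℂ] 𝓢((Fin (3 * 2) → mixedSpace (↥(maximalRealSubfield (L : Type)))), ℂ))
    (Mf : FinSB (↥(maximalRealSubfield (L : Type))) (Fin (3 * 2)) →ₗ[ℂ] FinSB (↥(maximalRealSubfield (L : Type))) (Fin (3 * 2)))
    (hAM : ∀ (Φ : 𝓢((Fin (3 * 2) → mixedSpace (↥(maximalRealSubfield (L : Type)))), ℂ)) (f : FinSB (↥(maximalRealSubfield (L : Type))) (Fin (3 * 2))),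
      Mω (piSchwartzBruhatEquiv (↥(maximalRealSubfield (L : Type))) (Fin (3 * 2)) (Φ ⊗ₜ f)) = piSchwartzBruhatEquiv (↥(maximalRealSubfield (L : Type))) (Fin (3 * 2)) (A Φ ⊗ₜ Mf f))
    {f₀ : FinSB (↥(maximalRealSubfield (L : Type))) (Fin (3 * 2))} (hf₀ : Mf f₀ ≠ 0) :
    ∃ c : ℂ, ∀ Φ : 𝓢((Fin (3 * 2) → mixedSpace (↥(maximalRealSubfield (L : Type)))), ℂ),
      A Φ = c • cmArchWeilRep (L : Type) finProdFinEquiv (frameD V) (frameD_real V) (frameD_ne V) (dW S) (dW_real S) (dW_ne S) hGR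
        (1, conjTransportK S) (SchwartzMap.compCLMOfContinuousLinearEquiv ℂ (conjFrameTransport V S) Φ) := by
  subst hh₀
  obtain ⟨c, hc⟩ := exists_archFactor_eq_smul_cmArchWeilRep_compCLE (L : Type) finProdFinEquiv (frameD V) (frameD_real V) (frameD_ne V)
    (dW S) (dW_real S) (dW_ne S) hGR (1, conjTransportK S) _ Mω hM A Mf hAM hf₀ (conjFrameTransport V S).symm
    (fun w => (conjFrameTransport V S).symm (relabelInvArch C w))
    (archAct_conjLeviElt_fst V S hW' hJW' hg C hC) (archAct_conjLeviElt_snd V S hW' hJW' hg C hC)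
  exact ⟨c, fun Φ => by rw [hc Φ, compCLE_apply, ContinuousLinearEquiv.symm_symm]⟩

/-- **bridge to the (34)-currency term of record**: K-1's `seesawElement` at the CM see-saw data of `S` (`M₁ = M₂ = 1`, `g = g₀ ⊗ 1`,
`C = gramConj`, as inside `cmConjLineTensorFin` / period-1's `cmConjSeesawMp`) IS `conjSeesawSp V S …` (definitional, `Fin (1 + 1) = Fin 2`). -/
theorem seesawElement_eq_conjSeesawSp :
    seesawElement (↥(maximalRealSubfield (L : Type))) (L : Type) (IsCMField.complexConj (L : Type)) 3 1 1 (Matrix.diagonal (frameD V)) (Matrix.diagonal (dW S))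
        (Matrix.diagonal (lineVec (L : Type) (dW' S 0))) (Matrix.diagonal (lineVec (L : Type) (dW' S 1)))
        (complexConj_imagUnit (L : Type)) (imagUnit_ne_zero (L : Type)) (imagUnit_mul_self (L : Type))
        (realDiagonal_isSymm (L : Type) (frameD V) (frameD_real V)) (realDiagonal_isSymm (L : Type) (dW S) (dW_real S))
        (realDiagonal_isSymm (L : Type) (lineVec (L : Type) (dW' S 0)) fun _ => dW'_real S 0)
        (realDiagonal_isSymm (L : Type) (lineVec (L : Type) (dW' S 1)) fun _ => dW'_real S 1)
        (realDiagonal_map (L : Type) (frameD V) (frameD_real V)).symm (realDiagonal_map (L : Type) (dW S) (dW_real S)).symm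
        (realDiagonal_map (L : Type) (lineVec (L : Type) (dW' S 0)) fun _ => dW'_real S 0).symm
        (realDiagonal_map (L : Type) (lineVec (L : Type) (dW' S 1)) fun _ => dW'_real S 1).symm
        (adelicIsometry_conj (L : Type) (dW S) (dW' S) S.isoGL (isoGL_hg₀ S))
        (gramIntertwiner_conj (L : Type) (dW S) (dW_real S) (dW_ne S) (dW' S) (dW'_real S) (dW'_ne S)
          (realDiagonal (L : Type) (frameD V) (frameD_real V))) =
      conjSeesawSp V S
        (isSymm_finSum (realDiagonal_isSymm (L : Type) (lineVec (L : Type) (dW' S 0)) fun _ => dW'_real S 0)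
          (realDiagonal_isSymm (L : Type) (lineVec (L : Type) (dW' S 1)) fun _ => dW'_real S 1))
        (finSum_eq_map_finSum (↥(maximalRealSubfield (L : Type))) (L : Type) 1 1 (Matrix.diagonal (lineVec (L : Type) (dW' S 0))) (Matrix.diagonal (lineVec (L : Type) (dW' S 1)))
          (realDiagonal_map (L : Type) (lineVec (L : Type) (dW' S 0)) fun _ => dW'_real S 0).symm
          (realDiagonal_map (L : Type) (lineVec (L : Type) (dW' S 1)) fun _ => dW'_real S 1).symm)
        (adelicIsometry_conj (L : Type) (dW S) (dW' S) S.isoGL (isoGL_hg₀ S))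
        (gramConj (L : Type) (N := 3) (dW S) (dW_real S) (dW_ne S) (dW' S) (dW'_real S) (dW'_ne S))
        (gramIntertwiner_conj (L : Type) (dW S) (dW_real S) (dW_ne S) (dW' S) (dW'_real S) (dW'_ne S)
          (realDiagonal (L : Type) (frameD V) (frameD_real V))) := rfl

end LeviShape

end HodgeCM.Model.ArchLevi

end
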